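import Mathlib
import HarnessLib

/-!
# The Kemperman–Scherk(–Wehn) theorem on the number of representations in a product set

Topic: `Literature/Combinatorics/Additive`.  Cell `mm-stpp` (D-0046), seat `mm-stpp-lit`: the
published theorem behind "Theorem A" of the STPP census (the Neumann-type packing inequality
`Summit.MatrixMultiplication.MatrixMultiplication.Theorems.STPPNeumannPacking.stpp_neumann_packing`,
p402899) — see `HOME/mm-stpp-lit/KNESER-KILLS.md` §1 for the three-line reduction.

**Theorem (Kemperman 1956; Scherk 1955 for abelian groups; independently Wehn).**  Let `A, B` be
finite non-empty subsets of a group `G` and `c ∈ A·B`.  Then the number `r(c)` of representations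
`c = a·b` (`a ∈ A`, `b ∈ B`) satisfies `|A| + |B| ≤ |A·B| + r(c)`.  In particular
(Kemperman 1956, Thm. 3, as restated by Olson 1984, Thm. 4): if some element of `A·B` is
represented exactly once, then `|A·B| ≥ |A| + |B| − 1`.

* `Literature.Combinatorics.Additive.kemperman_card_add_card_le_of_unique_mul` (additive:
  `kemperman_card_add_card_le_of_unique_add`) — the unique-representation form, any group;
* `Literature.Combinatorics.Additive.kempermanScherk_card_add_card_le_mul` (additive:
  `kempermanScherk_card_add_card_le_add`) — the general form with the representation count
  `#{(a,b) ∈ A × B : a·b = c}`, any group.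

Proof (Kemperman's transformation, following Olson 1984 §2, proof of Thm. 4).  Normalise to
`1 ∈ A ∩ B` with `1 = 1·1` the unique representation of `1`.  If `A ∩ B = {1}` then
`A ∪ B ⊆ A·B` gives the claim.  Otherwise pick `d ∈ A ∩ B`, `d ≠ 1`, and pass to one of the two
Kemperman transforms `(A ∪ A d, B ∩ d⁻¹B)`, `(A ∩ A d⁻¹, B ∪ d B)` (Mathlib's
`Finset.mulETransformRight/Left`, here written with `filter`/`image`): both keep the product inside
`A·B`, keep `1` in both sets and keep the representation of `1` unique; the sum of the four new
cardinalities is `2(|A| + |B|)`, and `|A ∪ A d| > |A|` because `1 ∉ A d`; so along one of the two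
the pair `(|A|+|B|, |A|)` increases lexicographically while everything stays inside the fixed
finite set `A·B` — a terminating induction.  The general form follows by deleting from `B` all
but one of the `b`'s that represent `c` (Scherk's reduction).

Mathlib has the Cauchy–Davenport/DeVos inequality `Finset.cauchy_davenport_minOrder_mul` and the
e-transform API, but neither this theorem nor Kneser's theorem (as of the pinned Mathlib).

## References
* J. H. B. Kemperman, *On complexes in a semigroup*, Indag. Math. 18 (1956) 247–254 — the
  original for arbitrary groups; its Thm 3 is the unique-representation form as cited by Olson
  [cite: Kemperman1956, Thm 3]; the representation-count form is ascribed to Kemperman and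
  (independently) Wehn by Olson and to Kemperman–Scherk by Lev.
* J. E. Olson, *On the sum of two sets in a group*, J. Number Theory 18 (1984) 110–120: Thm 3
  (Kemperman's transformation) and Thm 4, p. 112 [cite: Olson1984, Thm 3, Thm 4].
* V. F. Lev, *Restricted set addition in Abelian groups: results and conjectures*, J. Théor.
  Nombres Bordeaux 17 (2005) 181–193, Thm 1.3, p. 184 (statement for abelian groups and history:
  Moser 1951; P. Scherk, Amer. Math. Monthly 62 (1955) 46–47; Kemperman 1956, 1960)
  [cite: Lev2005, Thm 1.3].
-/

namespace Literature.Combinatorics.Additive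

open Finset
open scoped Pointwise

variable {G : Type*} [Group G] [DecidableEq G]

namespace KempermanScherk

/-! ### The two Kemperman transforms, written with `filter` / `image` -/

/-- `|A ∪ A·d| + |{a ∈ A : a·d ∈ A}| = 2|A|` (bookkeeping for Kemperman's transformation). [cite: Olson1984, Thm 3] -/
@[to_additive]
private theorem card_mulRight_transform (A : Finset G) (d : G) :
    (A ∪ A.image (· * d)).card + (A.filter (fun a => a * d ∈ A)).card = A.card + A.card := by
  have hI : A ∩ A.image (· * d) = (A.filter (fun a => a * d ∈ A)).image (· * d) := by
    ext x
    simp only [mem_inter, mem_image, mem_filter]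
    constructor
    · rintro ⟨hx, a, ha, rfl⟩
      exact ⟨a, ⟨ha, hx⟩, rfl⟩
    · rintro ⟨a, ⟨ha, had⟩, rfl⟩
      exact ⟨had, a, ha, rfl⟩
  have h1 := card_union_add_card_inter A (A.image (· * d))
  have h2 : (A.image (· * d)).card = A.card := card_image_of_injective _ (mul_left_injective d)
  have h3 : ((A.filter (fun a => a * d ∈ A)).image (· * d)).card =
      (A.filter (fun a => a * d ∈ A)).card :=
    card_image_of_injective _ (mul_left_injective d)
  rw [hI, h3, h2] at h1
  exact h1

/-- `|B ∪ d·B| + |{b ∈ B : d·b ∈ B}| = 2|B|` (bookkeeping for Kemperman's transformation). [cite: Olson1984, Thm 3] -/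
@[to_additive]
private theorem card_leftMul_transform (B : Finset G) (d : G) :
    (B ∪ B.image (d * ·)).card + (B.filter (fun b => d * b ∈ B)).card = B.card + B.card := by
  have hI : B ∩ B.image (d * ·) = (B.filter (fun b => d * b ∈ B)).image (d * ·) := by
    ext x
    simp only [mem_inter, mem_image, mem_filter]
    constructor
    · rintro ⟨hx, b, hb, rfl⟩
      exact ⟨b, ⟨hb, hx⟩, rfl⟩
    · rintro ⟨b, ⟨hb, hdb⟩, rfl⟩
      exact ⟨hdb, b, hb, rfl⟩
  have h1 := card_union_add_card_inter B (B.image (d * ·))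
  have h2 : (B.image (d * ·)).card = B.card := card_image_of_injective _ (mul_right_injective d)
  have h3 : ((B.filter (fun b => d * b ∈ B)).image (d * ·)).card =
      (B.filter (fun b => d * b ∈ B)).card :=
    card_image_of_injective _ (mul_right_injective d)
  rw [hI, h3, h2] at h1
  exact h1

/-- The right transform does not enlarge the product: `(A ∪ A d)·(B ∩ d⁻¹B) ⊆ A·B`. [cite: Olson1984, Thm 3 (i)] -/
@[to_additive]
private theorem mulRight_transform_mul_subset (A B : Finset G) (d : G) :
    (A ∪ A.image (· * d)) * (B.filter (fun b => d * b ∈ B)) ⊆ A * B := by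
  intro x hx
  obtain ⟨u, hu, v, hv, rfl⟩ := mem_mul.1 hx
  rw [mem_filter] at hv
  rcases mem_union.1 hu with huA | huI
  · exact mem_mul.2 ⟨u, huA, v, hv.1, rfl⟩
  · obtain ⟨a, ha, rfl⟩ := mem_image.1 huI
    exact mem_mul.2 ⟨a, ha, d * v, hv.2, by simp only [mul_assoc]⟩

/-- The left transform does not enlarge the product: `(A ∩ A d⁻¹)·(B ∪ d B) ⊆ A·B`. [cite: Olson1984, Thm 3 (i)] -/
@[to_additive]
private theorem leftMul_transform_mul_subset (A B : Finset G) (d : G) :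
    (A.filter (fun a => a * d ∈ A)) * (B ∪ B.image (d * ·)) ⊆ A * B := by
  intro x hx
  obtain ⟨u, hu, v, hv, rfl⟩ := mem_mul.1 hx
  rw [mem_filter] at hu
  rcases mem_union.1 hv with hvB | hvI
  · exact mem_mul.2 ⟨u, hu.1, v, hvB, rfl⟩
  · obtain ⟨b, hb, rfl⟩ := mem_image.1 hvI
    exact mem_mul.2 ⟨u * d, hu.2, b, hb, by simp only [mul_assoc]⟩

/-- If `1 ∈ A`, `d ∈ B`, `d ≠ 1` and `1 = a·b` only trivially on `A × B`, then some `a ∈ A` has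
`a·d ∉ A` (indeed `1 ∉ A·d`), so the filter is a proper subset. [cite: Olson1984, proof of Thm 4] -/
@[to_additive]
private theorem card_filter_mul_mem_lt (A B : Finset G) (d : G) (h1A : (1 : G) ∈ A) (hdB : d ∈ B) (hd1 : d ≠ 1)
    (huniq : ∀ a ∈ A, ∀ b ∈ B, a * b = 1 → a = 1 ∧ b = 1) :
    (A.filter (fun a => a * d ∈ A)).card < A.card := by
  refine card_lt_card ⟨filter_subset _ _, fun hsub => ?_⟩
  -- if every `a ∈ A` has `a d ∈ A`, then `A d = A ∋ 1`, i.e. `a d = 1` for some `a ∈ A`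
  have hall : ∀ a ∈ A, a * d ∈ A := fun a ha => (mem_filter.1 (hsub ha)).2
  have himg : A.image (· * d) = A := by
    apply eq_of_subset_of_card_le
    · intro x hx
      obtain ⟨a, ha, rfl⟩ := mem_image.1 hx
      exact hall a ha
    · rw [card_image_of_injective _ (mul_left_injective d)]
  have h1 : (1 : G) ∈ A.image (· * d) := by rw [himg]; exact h1A
  obtain ⟨a, ha, had⟩ := mem_image.1 h1
  exact hd1 (huniq a ha d hdB had).2

/-- The right transform keeps the representation of `1` unique. [cite: Olson1984, proof of Thm 4] -/
@[to_additive]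
private theorem unique_mulRight_transform (A B : Finset G) (d : G) (hdA : d ∈ A) (hd1 : d ≠ 1)
    (huniq : ∀ a ∈ A, ∀ b ∈ B, a * b = 1 → a = 1 ∧ b = 1) :
    ∀ x ∈ A ∪ A.image (· * d), ∀ y ∈ B.filter (fun b => d * b ∈ B), x * y = 1 → x = 1 ∧ y = 1 := by
  intro x hx y hy hxy
  rw [mem_filter] at hy
  rcases mem_union.1 hx with hxA | hxI
  · exact huniq x hxA y hy.1 hxy
  · obtain ⟨a, ha, rfl⟩ := mem_image.1 hxI
    have h : a * (d * y) = 1 := by simpa only [mul_assoc] using hxy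
    have hdy : d * y = 1 := (huniq a ha (d * y) hy.2 h).2
    exact absurd (huniq d hdA y hy.1 hdy).1 hd1

/-- The left transform keeps the representation of `1` unique. [cite: Olson1984, proof of Thm 4] -/
@[to_additive]
private theorem unique_leftMul_transform (A B : Finset G) (d : G) (hdB : d ∈ B) (hd1 : d ≠ 1)
    (huniq : ∀ a ∈ A, ∀ b ∈ B, a * b = 1 → a = 1 ∧ b = 1) :
    ∀ x ∈ A.filter (fun a => a * d ∈ A), ∀ y ∈ B ∪ B.image (d * ·), x * y = 1 → x = 1 ∧ y = 1 := by
  intro x hx y hy hxy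
  rw [mem_filter] at hx
  rcases mem_union.1 hy with hyB | hyI
  · exact huniq x hx.1 y hyB hxy
  · obtain ⟨b, hb, rfl⟩ := mem_image.1 hyI
    have h : (x * d) * b = 1 := by simpa only [mul_assoc] using hxy
    have hxd : x * d = 1 := (huniq (x * d) hx.2 b hb h).1
    exact absurd (huniq x hx.1 d hdB hxd).2 hd1

/-- The engine: normalised pairs (`1 ∈ A ∩ B`, `1` uniquely represented) with product inside a
fixed finite set `S` satisfy `|A| + |B| ≤ |A·B| + 1`; induction on the lexicographic measure
`(2|S| − |A| − |B|, |S| − |A|)`. [cite: Olson1984, proof of Thm 4] -/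
@[to_additive]
private theorem mul_aux (S : Finset G) (k : ℕ) :
    ∀ (l : ℕ) (A B : Finset G), A * B ⊆ S → (1 : G) ∈ A → (1 : G) ∈ B →
      (∀ a ∈ A, ∀ b ∈ B, a * b = 1 → a = 1 ∧ b = 1) →
      S.card + S.card - (A.card + B.card) = k → S.card - A.card = l →
      A.card + B.card ≤ (A * B).card + 1 := by
  induction k using Nat.strong_induction_on with
  | _ k ihk =>
  intro l
  induction l using Nat.strong_induction_on with
  | _ l ihl =>
  intro A B hABS h1A h1B huniq hk hl
  have hAsub : A ⊆ A * B := fun a ha => mem_mul.2 ⟨a, ha, 1, h1B, mul_one a⟩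
  have hBsub : B ⊆ A * B := fun b hb => mem_mul.2 ⟨1, h1A, b, hb, one_mul b⟩
  have hAcard : A.card ≤ S.card := card_le_card (hAsub.trans hABS)
  have hBcard : B.card ≤ S.card := card_le_card (hBsub.trans hABS)
  by_cases htriv : ∀ d ∈ A ∩ B, d = 1
  · -- `A ∩ B = {1}`: then `A ∪ B ⊆ A·B` already gives the bound
    have hinter : (A ∩ B).card ≤ 1 :=
      card_le_one.2 fun x hx y hy => by rw [htriv x hx, htriv y hy]
    have hunion : (A ∪ B).card ≤ (A * B).card := card_le_card (union_subset hAsub hBsub)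
    have h := card_union_add_card_inter A B
    omega
  · push Not at htriv
    obtain ⟨d, hdAB, hd1⟩ := htriv
    have hdA : d ∈ A := (mem_inter.1 hdAB).1
    have hdB : d ∈ B := (mem_inter.1 hdAB).2
    -- the four transformed sets and their bookkeeping
    have hcA := card_mulRight_transform A d
    have hcB := card_leftMul_transform B d
    have hlt := card_filter_mul_mem_lt A B d h1A hdB hd1 huniq
    -- right transform data
    have hRsub : (A ∪ A.image (· * d)) * (B.filter (fun b => d * b ∈ B)) ⊆ S :=
      (mulRight_transform_mul_subset A B d).trans hABS
    have hR1A : (1 : G) ∈ A ∪ A.image (· * d) := mem_union_left _ h1A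
    have hR1B : (1 : G) ∈ B.filter (fun b => d * b ∈ B) :=
      mem_filter.2 ⟨h1B, by simpa only [mul_one] using hdB⟩
    have hRuniq := unique_mulRight_transform A B d hdA hd1 huniq
    have hRsubA : (A ∪ A.image (· * d)) ⊆ (A ∪ A.image (· * d)) * (B.filter (fun b => d * b ∈ B)) :=
      fun x hx => mem_mul.2 ⟨x, hx, 1, hR1B, mul_one x⟩
    have hRsubB : (B.filter (fun b => d * b ∈ B)) ⊆
        (A ∪ A.image (· * d)) * (B.filter (fun b => d * b ∈ B)) :=
      fun y hy => mem_mul.2 ⟨1, hR1A, y, hy, one_mul y⟩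
    have hRcardA : (A ∪ A.image (· * d)).card ≤ S.card := card_le_card (hRsubA.trans hRsub)
    have hRcardB : (B.filter (fun b => d * b ∈ B)).card ≤ S.card := card_le_card (hRsubB.trans hRsub)
    have hRprod : ((A ∪ A.image (· * d)) * (B.filter (fun b => d * b ∈ B))).card ≤ (A * B).card :=
      card_le_card (mulRight_transform_mul_subset A B d)
    -- left transform data
    have hLsub : (A.filter (fun a => a * d ∈ A)) * (B ∪ B.image (d * ·)) ⊆ S :=
      (leftMul_transform_mul_subset A B d).trans hABS
    have hL1A : (1 : G) ∈ A.filter (fun a => a * d ∈ A) :=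
      mem_filter.2 ⟨h1A, by simpa only [one_mul] using hdA⟩
    have hL1B : (1 : G) ∈ B ∪ B.image (d * ·) := mem_union_left _ h1B
    have hLuniq := unique_leftMul_transform A B d hdB hd1 huniq
    have hLsubA : (A.filter (fun a => a * d ∈ A)) ⊆
        (A.filter (fun a => a * d ∈ A)) * (B ∪ B.image (d * ·)) :=
      fun x hx => mem_mul.2 ⟨x, hx, 1, hL1B, mul_one x⟩
    have hLsubB : (B ∪ B.image (d * ·)) ⊆ (A.filter (fun a => a * d ∈ A)) * (B ∪ B.image (d * ·)) :=
      fun y hy => mem_mul.2 ⟨1, hL1A, y, hy, one_mul y⟩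
    have hLcardA : (A.filter (fun a => a * d ∈ A)).card ≤ S.card := card_le_card (hLsubA.trans hLsub)
    have hLcardB : (B ∪ B.image (d * ·)).card ≤ S.card := card_le_card (hLsubB.trans hLsub)
    have hLprod : ((A.filter (fun a => a * d ∈ A)) * (B ∪ B.image (d * ·))).card ≤ (A * B).card :=
      card_le_card (leftMul_transform_mul_subset A B d)
    -- one of the two transforms does not decrease `|A| + |B|`
    by_cases hcase : A.card + B.card ≤
        (A ∪ A.image (· * d)).card + (B.filter (fun b => d * b ∈ B)).card
    · -- right transform: `|A|` strictly increases, the sum does not decrease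
      by_cases hk' : S.card + S.card -
          ((A ∪ A.image (· * d)).card + (B.filter (fun b => d * b ∈ B)).card) < k
      · have := ihk _ hk' (S.card - (A ∪ A.image (· * d)).card) _ _ hRsub hR1A hR1B hRuniq rfl rfl
        omega
      · have hkeq : S.card + S.card -
            ((A ∪ A.image (· * d)).card + (B.filter (fun b => d * b ∈ B)).card) = k := by omega
        have hl' : S.card - (A ∪ A.image (· * d)).card < l := by omega
        have := ihl _ hl' _ _ hRsub hR1A hR1B hRuniq hkeq rfl
        omega
    · -- left transform: the sum strictly increases
      have hk' : S.card + S.card -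
          ((A.filter (fun a => a * d ∈ A)).card + (B ∪ B.image (d * ·)).card) < k := by omega
      have := ihk _ hk' (S.card - (A.filter (fun a => a * d ∈ A)).card) _ _ hLsub hL1A hL1B hLuniq
        rfl rfl
      omega

end KempermanScherk

/-- **Kemperman's theorem** (unique-representation form; any group).  If `a₀ ∈ A`, `b₀ ∈ B` and
`a₀·b₀` has no other representation `a·b` with `a ∈ A`, `b ∈ B`, then `|A| + |B| ≤ |A·B| + 1`.
(Olson 1984, Thm 4, p. 112: "If some element c₀ = a₀ + b₀ appears exactly once in A + B, then
|C| ≥ |A| + |B| − 1".) [cite: Kemperman1956, Thm 3] [cite: Olson1984, Thm 4] -/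
@[to_additive /-- **Kemperman's theorem** (unique-representation form; any additive group).  If
`a₀ ∈ A`, `b₀ ∈ B` and `a₀ + b₀` has no other representation `a + b` with `a ∈ A`, `b ∈ B`, then
`|A| + |B| ≤ |A + B| + 1` (Kemperman 1956 Thm 3; Olson 1984 Thm 4 — sources as for the
multiplicative statement). -/]
theorem kemperman_card_add_card_le_of_unique_mul {A B : Finset G} {a₀ b₀ : G} (ha₀ : a₀ ∈ A)
    (hb₀ : b₀ ∈ B) (huniq : ∀ a ∈ A, ∀ b ∈ B, a * b = a₀ * b₀ → a = a₀ ∧ b = b₀) :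
    A.card + B.card ≤ (A * B).card + 1 := by
  -- normalise: `A' = a₀⁻¹ A`, `B' = B b₀⁻¹`
  have hA' : (A.image (a₀⁻¹ * ·)).card = A.card :=
    card_image_of_injective _ (mul_right_injective a₀⁻¹)
  have hB' : (B.image (· * b₀⁻¹)).card = B.card :=
    card_image_of_injective _ (mul_left_injective b₀⁻¹)
  have hprod : A.image (a₀⁻¹ * ·) * B.image (· * b₀⁻¹) =
      (A * B).image (fun x => a₀⁻¹ * x * b₀⁻¹) := by
    ext x
    simp only [mem_mul, mem_image]
    constructor
    · rintro ⟨u, ⟨a, ha, rfl⟩, v, ⟨b, hb, rfl⟩, rfl⟩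
      exact ⟨a * b, ⟨a, ha, b, hb, rfl⟩, by simp only [mul_assoc]⟩
    · rintro ⟨y, ⟨a, ha, b, hb, rfl⟩, rfl⟩
      exact ⟨a₀⁻¹ * a, ⟨a, ha, rfl⟩, b * b₀⁻¹, ⟨b, hb, rfl⟩, by simp only [mul_assoc]⟩
  have hcardprod : (A.image (a₀⁻¹ * ·) * B.image (· * b₀⁻¹)).card = (A * B).card := by
    rw [hprod]
    refine card_image_of_injective _ ?_
    intro x y hxy
    have h := hxy
    simp only [mul_left_inj, mul_right_inj] at h
    exact h
  have h1A : (1 : G) ∈ A.image (a₀⁻¹ * ·) := mem_image.2 ⟨a₀, ha₀, by simp⟩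
  have h1B : (1 : G) ∈ B.image (· * b₀⁻¹) := mem_image.2 ⟨b₀, hb₀, by simp⟩
  have huniq' : ∀ a ∈ A.image (a₀⁻¹ * ·), ∀ b ∈ B.image (· * b₀⁻¹), a * b = 1 → a = 1 ∧ b = 1 := by
    intro u hu v hv huv
    obtain ⟨a, ha, rfl⟩ := mem_image.1 hu
    obtain ⟨b, hb, rfl⟩ := mem_image.1 hv
    have hab : a * b = a₀ * b₀ := by
      have h1 : a * (b * b₀⁻¹) = a₀ := by
        have h := congrArg (a₀ * ·) huv
        simpa only [mul_assoc, mul_inv_cancel_left, mul_one] using h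
      have h2 := congrArg (· * b₀) h1
      simpa only [mul_assoc, inv_mul_cancel, mul_one] using h2
    obtain ⟨rfl, rfl⟩ := huniq a ha b hb hab
    simp
  have h := KempermanScherk.mul_aux (A.image (a₀⁻¹ * ·) * B.image (· * b₀⁻¹)) _ _
    (A.image (a₀⁻¹ * ·)) (B.image (· * b₀⁻¹)) subset_rfl h1A h1B huniq' rfl rfl
  omega

/-- **The Kemperman–Scherk theorem** (Kemperman–Wehn for non-abelian groups).  For finite subsets
`A, B` of a group and `c ∈ A·B`, the number of representations `c = a·b` (`a ∈ A`, `b ∈ B`) is at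
least `|A| + |B| − |A·B|`:
`|A| + |B| ≤ |A·B| + #{(a,b) ∈ A × B : a·b = c}`.
(Lev 2005, Thm 1.3, p. 184: "ν(c) ≥ |A| + |B| − |A + B| for any c ∈ A + B", stated there for
abelian groups, with the history Moser 1951 / Scherk 1955 / Kemperman 1956, 1960; for arbitrary
groups the inequality is Kemperman's (1956; independently Wehn) and follows here from the
unique-representation form by Scherk's deletion argument.) [cite: Lev2005, Thm 1.3]
[cite: Kemperman1956, Thm 3] -/
@[to_additive /-- **The Kemperman–Scherk theorem** (additive form; any additive group).  For
finite subsets `A, B` and `c ∈ A + B`, the number of representations `c = a + b` is at least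
`|A| + |B| − |A + B|`: `|A| + |B| ≤ |A + B| + #{(a,b) ∈ A × B : a + b = c}` (Lev 2005
Thm 1.3; Kemperman 1956 — sources as for the multiplicative statement). -/]
theorem kempermanScherk_card_add_card_le_mul {A B : Finset G} {c : G} (hc : c ∈ A * B) :
    A.card + B.card ≤ (A * B).card + ((A ×ˢ B).filter (fun p => p.1 * p.2 = c)).card := by
  obtain ⟨a₀, ha₀, b₀, hb₀, rfl⟩ := mem_mul.1 hc
  -- representations of `a₀ b₀` ↔ second coordinates `b ∈ B` with `a₀ b₀ b⁻¹ ∈ A`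
  have hRcard : ((A ×ˢ B).filter (fun p => p.1 * p.2 = a₀ * b₀)).card =
      (B.filter (fun b => a₀ * b₀ * b⁻¹ ∈ A)).card := by
    refine card_bij (fun p _ => p.2) ?_ ?_ ?_
    · intro p hp
      simp only [mem_filter, mem_product] at hp ⊢
      refine ⟨hp.1.2, ?_⟩
      rw [← hp.2, mul_inv_cancel_right]
      exact hp.1.1
    · intro p hp q hq h
      simp only [mem_filter, mem_product] at hp hq
      have h1 : p.1 = q.1 := by
        have := hp.2.trans hq.2.symm
        rw [h] at this
        exact mul_right_cancel this
      exact Prod.ext h1 h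
    · intro b hb
      simp only [mem_filter] at hb
      refine ⟨(a₀ * b₀ * b⁻¹, b), ?_, rfl⟩
      simp only [mem_filter, mem_product]
      exact ⟨⟨hb.2, hb.1⟩, by rw [inv_mul_cancel_right]⟩
  -- delete the other representing `b`'s from `B`
  set R := B.filter (fun b => a₀ * b₀ * b⁻¹ ∈ A) with hR
  set B' := (B \ R) ∪ {b₀} with hB'
  have hRB : R ⊆ B := filter_subset _ _
  have hb₀R : b₀ ∈ R := by
    rw [hR, mem_filter]
    exact ⟨hb₀, by rw [mul_inv_cancel_right]; exact ha₀⟩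
  have hB'sub : B' ⊆ B := by
    intro b hb
    rcases mem_union.1 hb with h | h
    · exact (mem_sdiff.1 h).1
    · rw [mem_singleton.1 h]; exact hb₀
  have hB'card : B'.card + R.card = B.card + 1 := by
    have hdisj : Disjoint (B \ R) {b₀} := by
      rw [disjoint_singleton_right, mem_sdiff, not_and_not_right]
      exact fun _ => hb₀R
    rw [hB', card_union_of_disjoint hdisj, card_singleton]
    have := card_sdiff_add_card_eq_card hRB
    omega
  have huniq : ∀ a ∈ A, ∀ b ∈ B', a * b = a₀ * b₀ → a = a₀ ∧ b = b₀ := by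
    intro a ha b hb hab
    rcases mem_union.1 hb with h | h
    · exfalso
      refine (mem_sdiff.1 h).2 ?_
      rw [hR, mem_filter]
      refine ⟨(mem_sdiff.1 h).1, ?_⟩
      rw [← hab, mul_inv_cancel_right]
      exact ha
    · have hb0 : b = b₀ := mem_singleton.1 h
      subst hb0
      exact ⟨mul_right_cancel hab, rfl⟩
  have hb₀B' : b₀ ∈ B' := mem_union_right _ (mem_singleton_self _)
  have h1 := kemperman_card_add_card_le_of_unique_mul ha₀ hb₀B' huniq
  have h2 : (A * B').card ≤ (A * B).card := card_le_card (mul_subset_mul_left hB'sub)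
  rw [hRcard]
  omega

/-- The same inequality in the printed shape `|A·B| ≥ |A| + |B| − r(c)` (truncated subtraction
over `ℕ`). [cite: Lev2005, Thm 1.3] [cite: Olson1984, Thm 4] -/
@[to_additive /-- The printed shape `|A + B| ≥ |A| + |B| − r(c)` (truncated subtraction over
`ℕ`; sources as for the multiplicative statement). -/]
theorem kempermanScherk_card_mul_ge {A B : Finset G} {c : G} (hc : c ∈ A * B) :
    A.card + B.card - ((A ×ˢ B).filter (fun p => p.1 * p.2 = c)).card ≤ (A * B).card := by
  have := kempermanScherk_card_add_card_le_mul hc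
  omega

end Literature.Combinatorics.Additive
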